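/-
Copyright (c) 2026 the pub-hodgecm-mathlib formalisation cell (harness21).  Prover seat hodgecm-mathlib-LH4-p07 (g4), req620 Track A «(D-RAM) FOUR-FRAME» squad
(heir LEAD F0P3a-plan lineage; dealer LH4-plan lineage WORD #26 (1); MS ROAD A, Stage B₂ brick B7₂, FILE (E₂): THE B10₂-MULT SOCKET `hH` — the re-keyed `stub_B7_H`;
Stage B lead LH4-p10 (g2); re-keyed on multiplicity by LH4-p11 (g2) 2026-09-04T00:53Z).  2026-09-04.
-/
import Summits.HodgeConjecture.HodgeConjecture.Theorems.F0P3cDyRamDiagonalCoreHangingGlueCountTypeTwo       -- (D2₂) (this seat): glue heads; brings (C₂) tube head, (D1₂) empties, (iii)₂(b), ★ Tools (`finsum_mem_mul_eq_of_forall_eq`, `exists_of_polarisationCount_ne_zero`)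
import Summits.HodgeConjecture.HodgeConjecture.Theorems.F0P3cDyRamDiagonalCoreHangingRhoZeroCountTypeTwo    -- (H1b) (this seat): `polarisationCount_two_latt_rhoZeroH_eq`; brings (H1a), ★ p856296 `…GluedRhoZero` (`finsum_stabiliserWeight_rhoZero_tube_typeTwo_eq`)
import Summits.HodgeConjecture.HodgeConjecture.Theorems.F0P3cDyRamDiagonalTypeTwoGenuineCases               -- ★ p856409 (LH4-p04 (g2), B3₂ PART 8): `letters_of_hasAxis_H`
import Summits.HodgeConjecture.HodgeConjecture.Theorems.F0P3cDyRamDiagonalHNFAxisOfExponents               -- ★ (LH4-p04 (g2)): `hasAxis_latt_hnf_of_exponents`, `…_zero`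
import Summits.HodgeConjecture.HodgeConjecture.Theorems.F0P3cDyRamDiagonalStableLatticeHNFExists           -- ★ p855304: `exists_latt_eq_latt_hnf`, `latt_hnf_eq_latt_hnf_iff`
import Summits.HodgeConjecture.HodgeConjecture.Theorems.F0P3cDyRamElementDatumParity                        -- ★ LH4-p10 (g2): `isoceles_of_isElementDatum`, `le_min_depth_of_isElementDatum`
import Summits.HodgeConjecture.HodgeConjecture.Theorems.F0P3cDyRamGlueUnitRationalityDepth                   -- ★ LH4-p08 (g2): `exists_fixed_near_glueUnit_iff_le`
import Literature.NumberTheory.LocalFields.WildQuadraticDatumTraceBound                                      -- ★ p855934 (this seat's g3): `trace_bound_of_isRamifiedQuadraticDatum`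
import Literature.NumberTheory.Automorphic.UnitaryLatticeTreeDiagonalLiteralAntidiagonalModel                 -- ★ `v_eq_one_of_mul_map_eq_one`
import HarnessLib

/-!
# Crux `H413`, MS ROAD A, STAGE B₂ brick B7₂, FILE (E₂): THE B10₂-MULT SOCKET `hH` — the CORE-HANGING TYPE-2 strata `H(2ρ+1)` (axis `(2ρ+1, 2ρ+1, 2ρ+1)`, ALL `ρ ≥ 0`)
# contribute `(q−2)·q^{2ρ}` weighted by multiplicity on the tube `2ρ+1 ≤ min nᵢ`, plus the EQUILATERAL glue `q^{2ρ+1−⌈(2ρ+1−m)∕2⌉}` iff `n₁ = n₂ = n₃ = m < 2ρ+1 ≤ 2m`,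
# `2ρ+1−m ≤ m−d+1`

Cell `hodgecm-mathlib` (D-0151), FLOOR 0, crux item H413 = `stmt-HodgeConjecture-24833`; lane `--supports stmt-HodgeConjecture-24833 --as helper` (count-neutral).  THEOREMS ONLY
(no `def`, no instance, no notation, no `sorry`, default heartbeats).  HEAD = the `hH` binder of ★ p856349 `F0P3cDyRamStableCountTypeTwoGeneric.finsum_mem_normalisedStableLattices_eq_of_typeTwo_table`
(LH4-p10 (g2)'s weight-generic B10₂ assembly) at the re-keyed weight `f M := (polarisationCount σ ϖ 2 M : ℚ) * stabiliserWeight σ M` (LH4-p11 (g2) ruling 2026-09-04T00:53Z, p10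
01:00:57Z reading (iii)), RHS = skeleton₂ `B10-StableCountTypeTwo.SKELETON.v1` 08e5e6e2 `stub_B7_H` VERBATIM, for EVERY `ρ : ℕ`; binders as the type-0 socket ★ p856251:
`(hD : IsRamifiedQuadraticDatum σ ϖ d t) (h2 : |2| < 1) (hE : IsElementDatum σ ϖ N₀ α β n₁ n₂ n₃) (hN₀ : d ≤ N₀) (hT) (ρ)`, `[Fintype 𝓀[K]]`.
§1 BRIDGES.  `ρ ≥ 1`: `stratumTwo σ ϖ T (2ρ+1,2ρ+1,2ρ+1) = 𝒮_H₂(ρ)` (the frame set of (C₂)): HNF model (★ `exists_latt_eq_latt_hnf`) + ★ p04 `letters_of_hasAxis_H` (`b = ρ`, `c = 2ρ+1`,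
`|z| = |ϖ^ρ|`, `|xz − yϖ^ρ| = |ϖ^ρ|`, `x, y` units), letters `ζ := z∕ϖ^ρ`, `y″ := y − xζ`; conversely ★ `hasAxis_latt_hnf_of_exponents`.  `ρ = 0`: `stratumTwo σ ϖ T (1,1,1) = {M ∈ 𝓛₀(T) ∣
polarisable ∧ M = latt W(y,ζ), y ζ units}` (`W = (1 0 0; 0 1 0; y ζ ϖ)`; `latt (1 0 0; x 1 0; y z ϖ) = latt W(y − xz, z)` by ★ `latt_hnf_eq_latt_hnf_iff`; conversely ★ `…_of_exponents_zero`).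
§2 SOCKET.  `ρ = 0`: `d ≥ 1` and `d ≤ nᵢ` put `T` on the tube `1 ≤ min nᵢ`, the glue clause is void (`n₁ < 1` fails), `n₂ ≡ q − 2` on the set ((H1b)), and `Σ w = 1` over the `W`-lattices
(★ p856296 `finsum_stabiliserWeight_rhoZero_tube_typeTwo_eq` at `s = 0`; at `q = 2` the factor `q − 2` kills the term and `H(1)` is indeed empty) ⇒ `(q−2)·q⁰`.  `ρ ≥ 1`: the type-0
socket's case tree (★ p856251 §2) one notch higher — tube (C₂); `n₁ ≠ n₂` ⇒ empty ((D1₂), isoceles ★ `isoceles_of_isElementDatum`); foot `m < ρ+1` ⇒ empty; foot `m < 2ρ+1`, `n₃ ≠ m` ⇒ empty;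
EQUILATERAL ⇒ (D2₂) glue, the switch `2ρ+1−m ≤ m−d+1` being ★ LH4-p08 `exists_fixed_near_glueUnit_iff_le` at `j = 2ρ+1−m`.  `hTr` from `hD ∧ h2` (★ p855934).
* §1 `exists_frame_of_mem_stratumTwo_H`, `stratumTwo_H_eq`, `exists_frame_of_mem_stratumTwo_H_zero`, `stratumTwo_H_zero_eq`.
* §2 **`finsum_polarisationCount_mul_stabiliserWeight_hasAxis_H`** — the socket `hH`, all `ρ`.
HONEST LABEL.  Count-neutral; the census laws stay PROVER TARGETS until the MS assembly lands; `HC_CM` is proved only modulo the 7 printed citations (2 remaining named inputs: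
hLiu418 = `stmt-HodgeConjecture-24832`, h413 = `stmt-HodgeConjecture-24833`) until rung 0 closes.

## References
* [Kottwitz1986BaseChangeUnits] R. Kottwitz, *Base change for unit elements of Hecke algebras*, Compositio Math. 60 (1986), §1 pp. 240–241 (lattice counts via torus orbits).
* [Rogawski1990] J. D. Rogawski, *Automorphic Representations of Unitary Groups in Three Variables*, Ann. of Math. Stud. 123 (1990), §4.9 Prop. 4.9.1 (a) p. 55.
* [Serre1980Trees] J.-P. Serre, *Trees*, Springer (1980), Ch. II §1.1 (lattices `g·𝒪^N`, Hermite normal forms).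
-/

set_option autoImplicit false

noncomputable section

namespace Summit.HodgeConjecture.HodgeConjecture.Cruxes.H413.F0P3cDyRamDiagonalCoreHangingSocketTypeTwo

open Matrix WithZero
open Literature.NumberTheory.Automorphic Literature.NumberTheory.Automorphic.HermitianLattice
open Literature.NumberTheory.Automorphic.UnitaryLatticeTree Literature.NumberTheory.Automorphic.UnitaryThreeFourFrame
open Literature.NumberTheory.LocalFields.WildQuadraticDatum
open Summit.HodgeConjecture.HodgeConjecture.Cruxes.H413.F0P3cDyRamDiagonalTorusDefs
open Summit.HodgeConjecture.HodgeConjecture.Cruxes.H413.F0P3cDyRamDiagonalStrataDefs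
open Summit.HodgeConjecture.HodgeConjecture.Cruxes.H413.F0P3cDyRamDiagonalStableLatticeHNF
open Summit.HodgeConjecture.HodgeConjecture.Cruxes.H413.F0P3cDyRamDiagonalStableLatticeHNFExists
open Summit.HodgeConjecture.HodgeConjecture.Cruxes.H413.F0P3cDyRamDiagonalGluedTorusOrbits
open Summit.HodgeConjecture.HodgeConjecture.Cruxes.H413.F0P3cDyRamDiagonalGluedStabiliserIndex
open Summit.HodgeConjecture.HodgeConjecture.Cruxes.H413.F0P3cDyRamDiagonalGluedRhoZero
open Summit.HodgeConjecture.HodgeConjecture.Cruxes.H413.F0P3cDyRamDiagonalHNFAxisOfExponents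
open Summit.HodgeConjecture.HodgeConjecture.Cruxes.H413.F0P3cDyRamDiagonalTypeTwoGenuineCases
open Summit.HodgeConjecture.HodgeConjecture.Cruxes.H413.F0P3cDyRamDiagonalPolarisationCountTools
open Summit.HodgeConjecture.HodgeConjecture.Cruxes.H413.F0P3cDyRamDiagonalCoreHangingCountTypeTwo
open Summit.HodgeConjecture.HodgeConjecture.Cruxes.H413.F0P3cDyRamDiagonalCoreHangingFootTypeTwo
open Summit.HodgeConjecture.HodgeConjecture.Cruxes.H413.F0P3cDyRamDiagonalCoreHangingGlueCountTypeTwo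
open Summit.HodgeConjecture.HodgeConjecture.Cruxes.H413.F0P3cDyRamDiagonalCoreHangingRhoZeroCountTypeTwo
open Summit.HodgeConjecture.HodgeConjecture.Cruxes.H413.F0P3cDyRamElementDatumParity
open Summit.HodgeConjecture.HodgeConjecture.Cruxes.H413.F0P3cDyRamGlueUnitRationalityDepth
open scoped Valued WithZero Matrix MatrixGroups

variable {K : Type} [Field K] [Valued K ℤᵐ⁰]   -- `Type` (not `Type*`): ★ p04's `letters_of_hasAxis_H` and the datum predicates live in `Type`

/-! ## §1 The bridges: `stratumTwo σ ϖ T (2ρ+1, 2ρ+1, 2ρ+1)` is the core-hanging type-2 frame set -/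

/-- **(⊆), `ρ ≥ 1`: A MEMBER OF `stratumTwo σ ϖ T (2ρ+1,2ρ+1,2ρ+1)` IS A CORE-HANGING TYPE-2 FRAME LATTICE** `latt (1 0 0; x ϖ^ρ 0; xζ+y″ ϖ^ρζ ϖ^{2ρ+1})` with `x, ζ, y″, xζ+y″` units
(★ HNF model + ★ p04 `letters_of_hasAxis_H`; `ζ := z∕ϖ^ρ`, `y″ := y − xζ`). [cite: Kottwitz1986BaseChangeUnits, §1 pp. 240–241] [cite: Serre1980Trees, Ch. II §1.1] -/
theorem exists_frame_of_mem_stratumTwo_H {σ : K →+* K} (hvσ : ∀ a, Valued.v (σ a) = Valued.v a)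
    (hfix : ∀ x : K, σ x = x → x ≠ 0 → ∃ n : ℤ, Valued.v x = WithZero.exp (2 * n)) {ϖ : K} (hϖ : Valued.v ϖ = WithZero.exp (-1 : ℤ))
    (T : GL (Fin 3) K) {ρ : ℕ} (hρ : 1 ≤ ρ) {M : Submodule 𝒪[K] (Fin 3 → K)} (hM : M ∈ stratumTwo σ ϖ T ![2 * ρ + 1, 2 * ρ + 1, 2 * ρ + 1]) :
    M ∈ normalisedStableLattices T ∧ IsTypeTwoPolarisable σ ϖ M ∧
      ∃ x ζ y'' : K, Valued.v x = 1 ∧ Valued.v ζ = 1 ∧ Valued.v y'' = 1 ∧ Valued.v (x * ζ + y'') = 1 ∧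
        M = latt (!![1, 0, 0; x, ϖ ^ ρ, 0; x * ζ + y'', ϖ ^ ρ * ζ, ϖ ^ (2 * ρ + 1)] : Matrix (Fin 3) (Fin 3) K) := by
  obtain ⟨hM0, hpol, ha⟩ := (mem_stratumTwo_iff σ ϖ T _ M).1 hM
  have hM0' := hM0
  have hpol' := hpol
  obtain ⟨⟨g, rfl⟩, -, hnorm⟩ := hM0
  have hϖ0 : ϖ ≠ 0 := (Valuation.ne_zero_iff Valued.v).1 (by rw [hϖ]; exact WithZero.exp_ne_zero)
  have hvϖ : 0 < Valued.v ϖ := (Valuation.pos_iff _).2 hϖ0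
  have hle : latt (g : Matrix (Fin 3) (Fin 3) K) ≤ stdLattice K 3 := fun w hw => mem_stdLattice.2 fun i => (hnorm i).1 w hw
  obtain ⟨b, c, x, y, z, hx, hy, hz, hV⟩ := exists_latt_eq_latt_hnf hϖ g hle (hnorm 0).2
  rw [hV] at hnorm hpol ha hM0' hpol' ⊢
  obtain ⟨hb, hc, hzρ, hw, hy1, hx1⟩ := letters_of_hasAxis_H hvσ hfix hϖ b c hx hy hz hnorm ((isTypeTwoPolarisable_iff σ ϖ _).1 hpol) ha
  subst hb; subst hc
  have hpρ : Valued.v (ϖ ^ b) ≠ 0 := by rw [map_pow]; exact pow_ne_zero _ hvϖ.ne'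
  set ζ : K := z * (ϖ ^ b)⁻¹ with hζdef
  set y'' : K := y - x * ζ with hy''def
  have hzeq : ϖ ^ b * ζ = z := by rw [hζdef]; field_simp
  have hyeq : x * ζ + y'' = y := by rw [hy''def]; ring
  have hζ : Valued.v ζ = 1 := by rw [hζdef, map_mul, map_inv₀, hzρ, mul_inv_cancel₀ hpρ]
  have hy'' : Valued.v y'' = 1 := by
    have e : y'' = -((x * z - y * ϖ ^ b) * (ϖ ^ b)⁻¹) := by rw [hy''def, hζdef]; field_simp; ring
    rw [e, Valuation.map_neg, map_mul, map_inv₀, hw, mul_inv_cancel₀ hpρ]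
  refine ⟨hM0', hpol', x, ζ, y'', hx1 hρ, hζ, hy'', by rw [hyeq]; exact hy1 hρ, ?_⟩
  rw [hyeq, hzeq]

/-- **THE STRATUM `(2ρ+1, 2ρ+1, 2ρ+1)` IS THE CORE-HANGING TYPE-2 FRAME SET `𝒮_H₂(ρ)`** of (C₂) (`ρ ≥ 1`, any `T`); conversely ★ `hasAxis_latt_hnf_of_exponents` at
`(b, c, m, w) = (ρ, 2ρ+1, ρ, ρ)`. [cite: Kottwitz1986BaseChangeUnits, §1 pp. 240–241] [cite: Serre1980Trees, Ch. II §1.1] -/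
theorem stratumTwo_H_eq {σ : K →+* K} (hvσ : ∀ a, Valued.v (σ a) = Valued.v a)
    (hfix : ∀ x : K, σ x = x → x ≠ 0 → ∃ n : ℤ, Valued.v x = WithZero.exp (2 * n)) {ϖ : K} (hϖ : Valued.v ϖ = WithZero.exp (-1 : ℤ))
    (T : GL (Fin 3) K) {ρ : ℕ} (hρ : 1 ≤ ρ) :
    stratumTwo σ ϖ T ![2 * ρ + 1, 2 * ρ + 1, 2 * ρ + 1] =
      {M : Submodule 𝒪[K] (Fin 3 → K) | M ∈ normalisedStableLattices T ∧ IsTypeTwoPolarisable σ ϖ M ∧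
        ∃ x ζ y'' : K, Valued.v x = 1 ∧ Valued.v ζ = 1 ∧ Valued.v y'' = 1 ∧ Valued.v (x * ζ + y'') = 1 ∧
          M = latt (!![1, 0, 0; x, ϖ ^ ρ, 0; x * ζ + y'', ϖ ^ ρ * ζ, ϖ ^ (2 * ρ + 1)] : Matrix (Fin 3) (Fin 3) K)} := by
  ext M
  constructor
  · exact exists_frame_of_mem_stratumTwo_H hvσ hfix hϖ T hρ
  · rintro ⟨hM0, hpol, x, ζ, y'', hx1, hζ, hy'', hy, rfl⟩
    have hz : Valued.v (ϖ ^ ρ * ζ) = Valued.v (ϖ ^ ρ) := by rw [map_mul, hζ, mul_one]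
    have hw : Valued.v (x * (ϖ ^ ρ * ζ) - (x * ζ + y'') * ϖ ^ ρ) = Valued.v (ϖ ^ ρ) := by
      rw [show x * (ϖ ^ ρ * ζ) - (x * ζ + y'') * ϖ ^ ρ = -(y'' * ϖ ^ ρ) by ring, Valuation.map_neg, map_mul, hy'', one_mul]
    have h := hasAxis_latt_hnf_of_exponents hϖ ρ (2 * ρ + 1) hx1 hz hw
    rw [show ρ + (2 * ρ + 1 - ρ) = 2 * ρ + 1 by omega] at h
    exact (mem_stratumTwo_iff σ ϖ T _ _).2 ⟨hM0, hpol, h⟩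

/-- **(⊆), `ρ = 0`: A MEMBER OF `stratumTwo σ ϖ T (1,1,1)` IS `latt W(y, ζ)`**, `W = (1 0 0; 0 1 0; y ζ ϖ)` with `y, ζ` units (★ HNF model + ★ p04 `letters_of_hasAxis_H` at `ρ = 0`:
`b = 0`, `c = 1`, `|z| = 1`, `|xz − y| = 1`; then `latt (1 0 0; x 1 0; y z ϖ) = latt W(y − xz, z)` by ★ `latt_hnf_eq_latt_hnf_iff`). [cite: Kottwitz1986BaseChangeUnits, §1 pp. 240–241] [cite: Serre1980Trees, Ch. II §1.1] -/
theorem exists_frame_of_mem_stratumTwo_H_zero {σ : K →+* K} (hvσ : ∀ a, Valued.v (σ a) = Valued.v a)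
    (hfix : ∀ x : K, σ x = x → x ≠ 0 → ∃ n : ℤ, Valued.v x = WithZero.exp (2 * n)) {ϖ : K} (hϖ : Valued.v ϖ = WithZero.exp (-1 : ℤ))
    (T : GL (Fin 3) K) {M : Submodule 𝒪[K] (Fin 3 → K)} (hM : M ∈ stratumTwo σ ϖ T ![2 * 0 + 1, 2 * 0 + 1, 2 * 0 + 1]) :
    M ∈ normalisedStableLattices T ∧ IsTypeTwoPolarisable σ ϖ M ∧
      ∃ y ζ : K, Valued.v y = 1 ∧ Valued.v ζ = 1 ∧ M = latt (!![1, 0, 0; 0, 1, 0; y, ζ, ϖ] : Matrix (Fin 3) (Fin 3) K) := by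
  obtain ⟨hM0, hpol, ha⟩ := (mem_stratumTwo_iff σ ϖ T _ M).1 hM
  have hM0' := hM0
  have hpol' := hpol
  obtain ⟨⟨g, rfl⟩, -, hnorm⟩ := hM0
  have hϖ0 : ϖ ≠ 0 := (Valuation.ne_zero_iff Valued.v).1 (by rw [hϖ]; exact WithZero.exp_ne_zero)
  have hle : latt (g : Matrix (Fin 3) (Fin 3) K) ≤ stdLattice K 3 := fun w hw => mem_stdLattice.2 fun i => (hnorm i).1 w hw
  obtain ⟨b, c, x, y, z, hx, hy, hz, hV⟩ := exists_latt_eq_latt_hnf hϖ g hle (hnorm 0).2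
  rw [hV] at hnorm hpol ha hM0' hpol' ⊢
  obtain ⟨hb, hc, hz1, hw, -, -⟩ := letters_of_hasAxis_H hvσ hfix hϖ b c hx hy hz hnorm ((isTypeTwoPolarisable_iff σ ϖ _).1 hpol) ha
  subst hb; subst hc
  rw [pow_zero, map_one] at hz1
  rw [pow_zero, mul_one, map_one] at hw
  refine ⟨hM0', hpol', y - x * z, z, by rw [Valuation.map_sub_swap]; exact hw, hz1, ?_⟩
  have h := (latt_hnf_eq_latt_hnf_iff x y z 0 (y - x * z) z (pow_ne_zero 0 hϖ0) (pow_ne_zero (2 * 0 + 1) hϖ0)).2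
    ⟨by rw [sub_zero, pow_zero, map_one]; exact hx, by rw [sub_self, map_zero]; exact zero_le,
      by rw [show (y - (y - x * z)) * ϖ ^ 0 - z * (x - 0) = 0 by rw [pow_zero]; ring, map_zero]; exact zero_le⟩
  rw [h, pow_zero, show 2 * 0 + 1 = 1 from rfl, pow_one]

/-- **THE STRATUM `(1,1,1)` IS THE SET OF POLARISABLE `W`-LATTICES IN `𝓛₀(T)`** (`ρ = 0`, any `T`); conversely ★ `hasAxis_latt_hnf_of_exponents_zero` at `c = 1`, `m = w = 0`.
[cite: Kottwitz1986BaseChangeUnits, §1 pp. 240–241] [cite: Serre1980Trees, Ch. II §1.1] -/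
theorem stratumTwo_H_zero_eq {σ : K →+* K} (hvσ : ∀ a, Valued.v (σ a) = Valued.v a)
    (hfix : ∀ x : K, σ x = x → x ≠ 0 → ∃ n : ℤ, Valued.v x = WithZero.exp (2 * n)) {ϖ : K} (hϖ : Valued.v ϖ = WithZero.exp (-1 : ℤ))
    (T : GL (Fin 3) K) :
    stratumTwo σ ϖ T ![2 * 0 + 1, 2 * 0 + 1, 2 * 0 + 1] =
      {M : Submodule 𝒪[K] (Fin 3 → K) | M ∈ normalisedStableLattices T ∧ IsTypeTwoPolarisable σ ϖ M ∧
        ∃ y ζ : K, Valued.v y = 1 ∧ Valued.v ζ = 1 ∧ M = latt (!![1, 0, 0; 0, 1, 0; y, ζ, ϖ] : Matrix (Fin 3) (Fin 3) K)} := by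
  ext M
  constructor
  · exact exists_frame_of_mem_stratumTwo_H_zero hvσ hfix hϖ T
  · rintro ⟨hM0, hpol, y, ζ, hy, hζ, rfl⟩
    have hz : Valued.v ζ = Valued.v (ϖ ^ 0) := by rw [pow_zero, map_one]; exact hζ
    have hw : Valued.v (0 * ζ - y * ϖ ^ 0) = Valued.v (ϖ ^ 0) := by rw [zero_mul, zero_sub, pow_zero, mul_one, Valuation.map_neg, hy, map_one]
    have h := hasAxis_latt_hnf_of_exponents_zero hϖ 1 (by rw [map_zero]; exact zero_le_one) hz hw
    rw [Nat.sub_zero, pow_zero, pow_one] at h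
    exact (mem_stratumTwo_iff σ ϖ T _ _).2 ⟨hM0, hpol, h⟩

/-! ## §2 The socket `hH` — the re-keyed `stub_B7_H`, all `ρ` -/

section Socket

variable [Fintype 𝓀[K]] {σ : K →+* K} {ϖ : K} {d t : ℕ} {α β : K} {N₀ n₁ n₂ n₃ : ℕ} {T : GL (Fin 3) K}

/-- **B7₂ · THE RE-KEYED `stub_B7_H` = THE `hH` BINDER OF ★ p856349 AT `f = n₂·w`** (skeleton₂ 08e5e6e2 RHS TOKEN FOR TOKEN, every `ρ : ℕ`): the core-hanging type-2 stratum
`H(2ρ+1)` contributes `(q−2)·q^{2ρ}` iff `2ρ+1 ≤ min(n₁, n₂, n₃)`, plus the EQUILATERAL glue `q^{2ρ+1−⌈(2ρ+1−m)∕2⌉}` iff `n₁ = n₂ = n₃ = m < 2ρ+1 ≤ 2m`, `2ρ+1−m ≤ m−d+1`; at `ρ = 0`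
(`H(1)`) the datum puts `T` on the tube and the value is `q − 2` (= `n₂` on `H(1)`, times `Σ w = 1`). [cite: Rogawski1990, §4.9 Prop. 4.9.1 (a) p. 55] [cite: Kottwitz1986BaseChangeUnits, §1 pp. 240–241] -/
theorem finsum_polarisationCount_mul_stabiliserWeight_hasAxis_H (hD : IsRamifiedQuadraticDatum σ ϖ d t) (h2 : Valued.v (2 : K) < 1)
    (hE : IsElementDatum σ ϖ N₀ α β n₁ n₂ n₃) (hN₀ : d ≤ N₀) (hT : (T : Matrix (Fin 3) (Fin 3) K) = Matrix.diagonal ![α, β, 1]) (ρ : ℕ) :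
    ∑ᶠ M ∈ stratumTwo σ ϖ T ![2 * ρ + 1, 2 * ρ + 1, 2 * ρ + 1], (polarisationCount σ ϖ 2 M : ℚ) * stabiliserWeight σ M =
      (if 2 * ρ + 1 ≤ min n₁ (min n₂ n₃) then (((Fintype.card 𝓀[K] : ℚ) - 2) * (Fintype.card 𝓀[K] : ℚ) ^ (2 * ρ)) else 0) +
      (if n₁ = n₂ ∧ n₂ = n₃ ∧ n₁ < 2 * ρ + 1 ∧ 2 * ρ + 1 ≤ 2 * n₁ ∧ 2 * ρ + 1 - n₁ ≤ n₁ - d + 1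
        then ((Fintype.card 𝓀[K] : ℚ) ^ (2 * ρ + 1 - (2 * ρ + 1 - n₁ + 1) / 2)) else 0) := by
  have hTr := trace_bound_of_isRamifiedQuadraticDatum hD h2
  have hiso := isoceles_of_isElementDatum hD hE
  have hdmin := le_min_depth_of_isElementDatum hE hN₀
  obtain ⟨hσ, hvσ, hϖ, hfix, hd, hd1, -⟩ := hD
  obtain ⟨hα1, hβ1, -, hαne, hβne, h₁, h₂, h₃, hN₁, hN₂, hN₃⟩ := hE
  have hα : Valued.v α = 1 := UnitaryLatticeTree.v_eq_one_of_mul_map_eq_one hvσ hα1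
  have hβ : Valued.v β = 1 := UnitaryLatticeTree.v_eq_one_of_mul_map_eq_one hvσ hβ1
  have h₃' : Valued.v (β - α) = Valued.v ϖ ^ n₃ := by rw [Valuation.map_sub_swap]; exact h₃
  have hcard : (Nat.card 𝓀[K] : ℚ) = Fintype.card 𝓀[K] := by rw [Nat.card_eq_fintype_card]
  have hq : 1 < Nat.card 𝓀[K] := Finite.one_lt_card
  obtain ⟨hϖ0, hϖ1⟩ := ne_zero_and_v_lt_one_of_v_eq_exp hϖ
  rcases Nat.eq_zero_or_pos ρ with rfl | hρ
  · -- `ρ = 0`: the stratum `H(1)`; `T` is on the tube (`1 ≤ d ≤ nᵢ`), the glue clause is void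
    rw [if_pos (by omega), if_neg (by omega), add_zero, stratumTwo_H_zero_eq hvσ hfix hϖ T]
    -- `n₂ ≡ q − 2` on the set
    rw [finsum_mem_mul_eq_of_forall_eq (fun M => polarisationCount σ ϖ 2 M) (stabiliserWeight σ) (Nat.card 𝓀[K] - 2) ?_]
    swap
    · rintro M ⟨-, -, y, ζ, hy, hζ, rfl⟩
      obtain ⟨W, hW'⟩ := exists_gl_coe_eq_glued (0 : K) ζ y one_ne_zero hϖ0
      have hW : (W : Matrix (Fin 3) (Fin 3) K) = !![1, 0, 0; 0, 1, 0; y, ζ, ϖ] := by rw [hW', zero_mul, zero_add, one_mul]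
      rw [← hW]
      exact polarisationCount_two_latt_rhoZeroH_eq hσ hvσ hfix hϖ hd hy hζ W hW
    by_cases hq2 : Nat.card 𝓀[K] = 2
    · -- `q = 2`: both sides vanish
      rw [← hcard, hq2]; norm_num
    · have hq3 : 3 ≤ Nat.card 𝓀[K] := by omega
      -- every `W`-lattice is polarisable (`n₂ = q − 2 ≠ 0`), so the set is the `T`-stable `W`-family of ★ p856296 at `s = 0`
      have hset : {M : Submodule 𝒪[K] (Fin 3 → K) | M ∈ normalisedStableLattices T ∧ IsTypeTwoPolarisable σ ϖ M ∧
            ∃ y ζ : K, Valued.v y = 1 ∧ Valued.v ζ = 1 ∧ M = latt (!![1, 0, 0; 0, 1, 0; y, ζ, ϖ] : Matrix (Fin 3) (Fin 3) K)} =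
          {M | ∃ y ζ : K, Valued.v ζ = 1 ∧ Valued.v y = Valued.v ϖ ^ 0 ∧
            M = latt (!![1, 0, 0; 0, 1, 0; y, ζ, ϖ ^ (1 + 0)] : Matrix (Fin 3) (Fin 3) K) ∧ mapGL T M = M} := by
        ext M
        constructor
        · rintro ⟨⟨-, hTM, -⟩, -, y, ζ, hy, hζ, rfl⟩
          exact ⟨y, ζ, hζ, by rw [pow_zero]; exact hy, by rw [Nat.add_zero, pow_one], hTM⟩
        · rintro ⟨y, ζ, hζ, hy, hM, hTM⟩
          rw [Nat.add_zero, pow_one] at hM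
          rw [pow_zero] at hy
          obtain ⟨W, hW'⟩ := exists_gl_coe_eq_glued (0 : K) ζ y one_ne_zero hϖ0
          have hW : (W : Matrix (Fin 3) (Fin 3) K) = !![1, 0, 0; 0, 1, 0; y, ζ, ϖ] := by rw [hW', zero_mul, zero_add, one_mul]
          have hn : IsNormalisedLattice M := by
            rw [hM]
            exact (normalised_latt_hnf_iff (x := (0 : K)) (p := (1 : K)) (by rw [map_zero]; exact zero_le_one) hy.le hζ.le (by rw [map_one]) hϖ1.le).2
              ⟨Or.inl (map_one _), Or.inr (Or.inl hy)⟩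
          have hpol : IsTypeTwoPolarisable σ ϖ M := by
            rw [hM, ← hW]
            refine exists_of_polarisationCount_ne_zero ?_
            rw [polarisationCount_two_latt_rhoZeroH_eq hσ hvσ hfix hϖ hd hy hζ W hW]
            omega
          exact ⟨⟨⟨W, by rw [hM, hW]⟩, hTM, hn⟩, hpol, y, ζ, hy, hζ, hM⟩
      rw [hset, finsum_stabiliserWeight_rhoZero_tube_typeTwo_eq hσ hvσ hfix hϖ hd hα hβ T hT h₁ h₂ 0 (dvd_zero 2) (by omega) (by omega), ← hcard]
      push_cast [Nat.cast_sub (show 2 ≤ Nat.card 𝓀[K] by omega)]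
      ring
  · -- `ρ ≥ 1`
    rw [stratumTwo_H_eq hvσ hfix hϖ T hρ]
    by_cases htube : 2 * ρ + 1 ≤ min n₁ (min n₂ n₃)
    · -- the tube ((C₂))
      rw [if_pos htube, if_neg (by omega), add_zero,
        finsum_polarisationCount_mul_stabiliserWeight_coreHangingTwoStratum_tube hσ hvσ hfix hϖ hd hTr T hT hα hβ h₁ h₂ h₃' hρ (by omega) (by omega) (by omega), hcard]
    · rw [if_neg htube, zero_add]
      by_cases h12 : n₁ = n₂
      · -- the foot `n₁ = n₂ = m`
        subst h12
        by_cases hρm : ρ + 1 ≤ n₁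
        · by_cases h13 : n₁ = n₃
          · -- EQUILATERAL: `m < 2ρ+1` from `¬htube`
            subst h13
            have hm : n₁ < 2 * ρ + 1 := by omega
            have hαd : Valued.v (α - 1) ≤ Valued.v ϖ ^ d := by
              rw [h₂, v_varpi_pow hϖ, v_varpi_pow hϖ, WithZero.exp_le_exp]; omega
            have hβd : Valued.v (β - 1) ≤ Valued.v ϖ ^ d := by
              rw [h₁, v_varpi_pow hϖ, v_varpi_pow hϖ, WithZero.exp_le_exp]; omega
            have hg₀ : Valued.v ((β - 1) / (α - 1)) = 1 := by
              have hvϖ : 0 < Valued.v ϖ := (Valuation.pos_iff _).2 hϖ0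
              rw [map_div₀, h₁, h₂, div_self (pow_ne_zero _ hvϖ.ne')]
            have hswitch := exists_fixed_near_glueUnit_iff_le hσ hvσ hfix hϖ hd hd1 hα1 hβ1 hαne hβne hαd hβd h₃ (by omega) (2 * ρ + 1 - n₁)
            rw [hg₀, one_mul] at hswitch
            by_cases hsw : 2 * ρ + 1 - n₁ ≤ n₁ - d + 1
            · rw [if_pos ⟨rfl, rfl, hm, by omega, hsw⟩]
              obtain ⟨f, hσf, hf⟩ := hswitch.2 hsw
              rw [finsum_polarisationCount_mul_stabiliserWeight_coreHangingTwoStratum_glue hσ hvσ hfix hϖ hd hTr T hT hα hβ h₁ h₂ h₃' hρ hρm hm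
                (f₀ := -f) (by rw [map_neg, hσf]) (by rw [show -f + (β - 1) / (α - 1) = (β - 1) / (α - 1) - f by ring]; exact hf), hcard]
            · rw [if_neg (by rintro ⟨-, -, -, -, h⟩; exact hsw h)]
              refine finsum_polarisationCount_mul_stabiliserWeight_coreHangingTwoStratum_glue_eq_zero hσ hvσ hfix hϖ hd hTr T hT hα hβ h₁ h₂ h₃' hρ hρm hm ?_
              rintro ⟨f₀, hσf₀, hf₀⟩
              exact hsw (hswitch.1 ⟨-f₀, by rw [map_neg, hσf₀], by rw [show (β - 1) / (α - 1) - -f₀ = f₀ + (β - 1) / (α - 1) by ring]; exact hf₀⟩)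
          · -- `n₃ ≠ m`: then `m < 2ρ+1` (isoceles) and the stratum is empty
            have hm : n₁ < 2 * ρ + 1 := by
              rcases hiso with ⟨-, h13'⟩ | ⟨h, -⟩ | ⟨h, -⟩ <;> omega
            rw [if_neg (by rintro ⟨-, h, -⟩; exact h13 h),
              coreHangingTwoStratum_eq_empty_of_ne₃ σ hϖ T hT hα hβ h₁ h₂ h₃' hm (Ne.symm h13), finsum_mem_empty]
        · -- `m < ρ + 1`: (S1) fails
          rw [not_le] at hρm
          rw [if_neg (by omega), coreHangingTwoStratum_eq_empty_of_lt σ hϖ T hT hα hβ h₁ h₂ h₃' hρm, finsum_mem_empty]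
      · -- off the foot, below the tube: empty
        have hlow : ¬ (2 * ρ + 1 ≤ n₁ ∧ 2 * ρ + 1 ≤ n₂) := by
          rintro ⟨ha, hb⟩
          rcases hiso with ⟨h, -⟩ | ⟨h, -⟩ | ⟨h, -⟩ <;> omega
        rw [if_neg (by rintro ⟨h, -⟩; exact h12 h), coreHangingTwoStratum_eq_empty_of_ne σ hϖ T hT hα hβ h₁ h₂ h12 hlow, finsum_mem_empty]

end Socket

end Summit.HodgeConjecture.HodgeConjecture.Cruxes.H413.F0P3cDyRamDiagonalCoreHangingSocketTypeTwo

end
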